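import Literature.AlgebraicGeometry.Motives.ComplexPointsManifold
import Literature.AlgebraicGeometry.Motives.SmoothMorphismSubmersion
import Mathlib.Geometry.Manifold.MFDeriv.Basic
import Mathlib.Geometry.Manifold.ContMDiff.Defs
import Mathlib.Geometry.Manifold.Instances.Real
import HarnessLib

/-!
# `f(ℂ)` is a `C^∞` submersion of the real `2n`-manifolds `X(ℂ) → Y(ℂ)` for `f` smooth

For a scheme `X` smooth of relative dimension `n` and locally of finite type over `ℂ`, the tree's
`ComplexPoints.chartedSpace X n` (file `ComplexPointsManifold`) is the charted-space structure on
`X(ℂ)` modelled on `ℝ²ⁿ` whose charts are the holomorphic algebraic charts (Serre, GAGA §2 n°5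
Prop. 2, the tree's `exists_algebraicChart_holds`) followed by `ℂⁿ ≃ ℝ²ⁿ`. This file proves:

* `ComplexPoints.isManifold_real` — it is a `C^∞` real manifold (transition maps are holomorphic,
  GAGA §2 n°5: the coordinates of one algebraic chart are regular functions, read holomorphically in
  the other);
* `ComplexPoints.contMDiff_map` — for a `ℂ`-morphism `f : X ⟶ Y` between such schemes, `f(ℂ)` is
  `C^∞` (Serre, GAGA §2 n°5, p. 9: «`f` est aussi une application holomorphe de `X^h` dans `Y^h`»;
  read in algebraic charts the components of `f(ℂ)` are pulled-back regular functions,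
  `AlgPoints.evalOrZero_map`);
* `ComplexPoints.surjective_mfderiv_map` — if moreover `f` is smooth, `f(ℂ)` is a SUBMERSION: its
  manifold derivative is onto at every point (SGA1 XII Prop. 3.1 (iv); the complex Jacobian is onto
  by `surjective_fderiv_chart_map` of `SmoothMorphismSubmersion.lean` — tangent vectors as point
  derivations, extended along the formally smooth comorphism — and the real derivative is its
  realification conjugated by `ℂⁿ ≃ ℝ²ⁿ`).

These are the differential-topological hypotheses of Ehresmann's fibration theorem (the tree's
`Literature.AlgebraicTopology.Homotopy.ehresmann_fibration_holds`) for the proper submersion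
`f(ℂ)` of a smooth proper family (`Motives.Voisin2002_tubeRestrict_isIso`). Everything is proved.

## References

* J.-P. Serre, *Géométrie algébrique et géométrie analytique*, Ann. Inst. Fourier 6 (1956), §2 n°5
  (Prop. 2 and p. 9). [SerreGAGA1956]
* A. Grothendieck, M. Raynaud, *SGA 1*, Exp. XII, Thm. 1.1, Prop. 3.1 (iv). [SGA1]
-/

noncomputable section

open CategoryTheory AlgebraicGeometry Filter Topology
open scoped ContDiff Manifold
open Literature.AlgebraicGeometry.Motives.AlgPoints (evalOrZero evalOrZero_of_mem evalOrZero_of_not_mem)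
open Literature.NumberTheory.Transcendental

namespace Literature.AlgebraicGeometry.Motives

/-! ### The real-linear identification `ℂⁿ ≃ ℝ²ⁿ` -/

/-- `dim_ℝ ℂⁿ = dim_ℝ ℝ²ⁿ`. [folklore] -/
theorem finrank_real_pi_complex_eq (n : ℕ) :
    Module.finrank ℝ (Fin n → ℂ) = Module.finrank ℝ (EuclideanSpace ℝ (Fin (2 * n))) := by
  rw [Module.finrank_pi_fintype, finrank_euclideanSpace_fin]
  simp [Complex.finrank_real_complex, mul_comm]

/-- `complexToEuclidean n` is the homeomorphism underlying the real-linear isomorphism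
`ContinuousLinearEquiv.ofFinrankEq`. [folklore] -/
theorem complexToEuclidean_eq (n : ℕ) :
    complexToEuclidean n =
      (ContinuousLinearEquiv.ofFinrankEq (finrank_real_pi_complex_eq n)).toHomeomorph := rfl

/-- `complexToEuclidean n` as a function is the real-linear isomorphism `ofFinrankEq`. [folklore] -/
theorem coe_complexToEuclidean (n : ℕ) :
    ⇑(complexToEuclidean n) = ⇑(ContinuousLinearEquiv.ofFinrankEq (finrank_real_pi_complex_eq n)) :=
  rfl

/-- The inverse of `complexToEuclidean n` as a function is the inverse real-linear isomorphism.
[folklore] -/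
theorem coe_complexToEuclidean_symm (n : ℕ) :
    ⇑(complexToEuclidean n).symm =
      ⇑(ContinuousLinearEquiv.ofFinrankEq (finrank_real_pi_complex_eq n)).symm :=
  rfl

namespace ComplexPoints

/-! ### The algebraic charts and their properties -/

section Charts

variable (X : SchemeOver ℂ) (n : ℕ) [LocallyOfFiniteType X.hom] [SmoothOfRelativeDimension n X.hom]

/-- The defining properties of `algebraicChart X n P`: regular coordinates on an affine open
containing the source, and holomorphy of all regular functions read in the chart.
[cite: SerreGAGA1956, §2 n°5 Prop. 2] -/
theorem algebraicChart_spec (P : ComplexPoints X) :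
    (∃ (U : X.left.affineOpens) (x : Fin n → Γ(X.left, ↑U)),
        (algebraicChart X n P).source ⊆ {Q | Q.pt ∈ (↑U : X.left.Opens)} ∧
          ∀ Q ∈ (algebraicChart X n P).source, ∀ i,
            algebraicChart X n P Q i = evalOrZero ↑U (x i) Q) ∧
      ∀ (U : X.left.affineOpens) (s : Γ(X.left, ↑U)),
        ContDiffOn ℂ ω (evalOrZero ↑U s ∘ (algebraicChart X n P).symm)
          ((algebraicChart X n P).target ∩
            (algebraicChart X n P).symm ⁻¹' {Q | Q.pt ∈ (↑U : X.left.Opens)}) :=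
  (Literature.NumberTheory.Transcendental.exists_algebraicChart_holds X n P).choose_spec.2

attribute [local instance] ComplexPoints.chartedSpace

/-- The chart of `ComplexPoints.chartedSpace X n` at `P`. [folklore] -/
theorem chartAt_eq (P : ComplexPoints X) :
    chartAt (EuclideanSpace ℝ (Fin (2 * n))) P =
      (algebraicChart X n P).transHomeomorph (complexToEuclidean n) := rfl

/-- **Change of algebraic charts is holomorphic** (GAGA §2 n°5: each coordinate of the second chart
is a regular function, read holomorphically in the first). [cite: SerreGAGA1956, §2 n°5 Prop. 2] -/
theorem contDiffOn_algebraicChart_symm_trans (P P' : ComplexPoints X) :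
    ContDiffOn ℂ ω ((algebraicChart X n P).symm ≫ₕ algebraicChart X n P')
      ((algebraicChart X n P).symm ≫ₕ algebraicChart X n P').source := by
  obtain ⟨⟨U', x', hsrc', hx'⟩, -⟩ := algebraicChart_spec X n P'
  obtain ⟨-, hol⟩ := algebraicChart_spec X n P
  simp only [OpenPartialHomeomorph.trans_source, OpenPartialHomeomorph.symm_source,
    OpenPartialHomeomorph.coe_trans]
  refine contDiffOn_pi' fun i ↦ ?_
  refine ((hol U' (x' i)).mono ?_).congr ?_
  · rintro w ⟨hw, hw'⟩
    exact ⟨hw, hsrc' hw'⟩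
  · rintro w ⟨-, hw'⟩
    exact hx' _ hw' i

/-- **`X(ℂ)` is a `C^∞` real `2n`-manifold** for `X` smooth of relative dimension `n` and locally of
finite type over `ℂ` (with the algebraic-chart atlas `ComplexPoints.chartedSpace X n`): the
transition maps are the holomorphic changes of algebraic charts conjugated by the real-linear
`ℂⁿ ≃ ℝ²ⁿ`. [cite: SerreGAGA1956, §2 n°5 Prop. 2 and n°6] -/
theorem isManifold_real : IsManifold (𝓡 (2 * n)) ∞ (ComplexPoints X) := by
  refine isManifold_of_contDiffOn _ _ _ ?_
  rintro e e' ⟨P, rfl⟩ ⟨P', rfl⟩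
  set L := ContinuousLinearEquiv.ofFinrankEq (finrank_real_pi_complex_eq n) with hL
  set a := algebraicChart X n P with ha
  set a' := algebraicChart X n P' with ha'
  have hT := contDiffOn_algebraicChart_symm_trans X n P P'
  simp only [OpenPartialHomeomorph.trans_source, OpenPartialHomeomorph.symm_source,
    OpenPartialHomeomorph.coe_trans] at hT
  -- the real transition map is `L ∘ (a' ∘ a⁻¹) ∘ L⁻¹` on `L⁻¹⁻¹(a.target ∩ a⁻¹⁻¹ a'.source)`
  have hfun : ∀ z, ((a.transHomeomorph (complexToEuclidean n)).symm ≫ₕ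
      a'.transHomeomorph (complexToEuclidean n)) z = L (a' (a.symm (L.symm z))) := fun z => rfl
  have hsrc : ((a.transHomeomorph (complexToEuclidean n)).symm ≫ₕ
      a'.transHomeomorph (complexToEuclidean n)).source =
      L.symm ⁻¹' (a.target ∩ a.symm ⁻¹' a'.source) := by
    ext z
    simp only [OpenPartialHomeomorph.trans_source, OpenPartialHomeomorph.symm_source,
      OpenPartialHomeomorph.transHomeomorph_target, OpenPartialHomeomorph.transHomeomorph_source,
      Set.mem_inter_iff, Set.mem_preimage, OpenPartialHomeomorph.transHomeomorph_symm_apply,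
      coe_complexToEuclidean_symm]
    rfl
  simp only [modelWithCornersSelf_coe, modelWithCornersSelf_coe_symm, Set.range_id,
    Set.inter_univ, Set.preimage_id_eq, id_eq, Function.comp_id, Function.id_comp]
  rw [hsrc, show ((a.transHomeomorph (complexToEuclidean n)).symm ≫ₕ
      a'.transHomeomorph (complexToEuclidean n) : EuclideanSpace ℝ (Fin (2 * n)) → _) =
      L ∘ (a' ∘ a.symm) ∘ L.symm from funext hfun]
  refine L.contDiff.comp_contDiffOn (ContDiffOn.comp ?_ L.symm.contDiff.contDiffOn fun z hz => hz)
  exact (hT.restrict_scalars ℝ).of_le le_top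

end Charts

/-! ### `f(ℂ)` is `C^∞` -/

section Morphism

variable {X Y : SchemeOver ℂ} {n m : ℕ} [LocallyOfFiniteType X.hom] [SmoothOfRelativeDimension n X.hom]
  [LocallyOfFiniteType Y.hom] [SmoothOfRelativeDimension m Y.hom]

attribute [local instance] ComplexPoints.chartedSpace

/-- **The chart expression of `f(ℂ)` between algebraic charts is holomorphic** on its natural
domain: its `j`-th component near a point is the pulled-back regular function `f^* u_j` read in
the chart of `X(ℂ)` (`AlgPoints.evalOrZero_map`, restricted to an affine open inside `f⁻¹V₁`).
[cite: SerreGAGA1956, §2 n°5 (p. 9)] -/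
theorem contDiffOn_chart_map (f : X ⟶ Y) (P : ComplexPoints X) (Q : ComplexPoints Y) :
    ContDiffOn ℂ ω (algebraicChart Y m Q ∘ AlgPoints.map f ∘ (algebraicChart X n P).symm)
      ((algebraicChart X n P).target ∩
        (algebraicChart X n P).symm ⁻¹' (AlgPoints.map f ⁻¹' (algebraicChart Y m Q).source)) := by
  set aX := algebraicChart X n P with haX
  set aY := algebraicChart Y m Q with haY
  obtain ⟨⟨V₁, u, hsrcY, hu⟩, -⟩ := algebraicChart_spec Y m Q
  obtain ⟨-, holX⟩ := algebraicChart_spec X n P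
  refine contDiffOn_pi' fun j ↦ ?_
  refine contDiffOn_of_locally_contDiffOn fun z hz ↦ ?_
  obtain ⟨hzt, hzs⟩ := hz
  -- an affine open `U ∋ aX⁻¹ z` inside `f⁻¹ V₁`
  have hRV : (AlgPoints.map f (aX.symm z)).pt ∈ (↑V₁ : Y.left.Opens) := hsrcY hzs
  obtain ⟨U, hUaff, hRU, hUle⟩ : ∃ (U : X.left.Opens), IsAffineOpen U ∧ (aX.symm z).pt ∈ U ∧
      U ≤ f.left ⁻¹ᵁ ↑V₁ := by
    obtain ⟨_, ⟨U, hU, rfl⟩, hmem, hle⟩ := X.left.isBasis_affineOpens.exists_subset_of_mem_open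
      (show (aX.symm z).pt ∈ (f.left ⁻¹ᵁ ↑V₁ : X.left.Opens) from hRV) (f.left ⁻¹ᵁ ↑V₁).isOpen
    exact ⟨U, hU, hmem, hle⟩
  refine ⟨aX.target ∩ aX.symm ⁻¹' {R | R.pt ∈ U},
    aX.isOpen_inter_preimage_symm (AlgPoints.isOpen_setOf_pt_mem U), ⟨hzt, hRU⟩, ?_⟩
  have hol := holX ⟨U, hUaff⟩ (f.left.appLE ↑V₁ U hUle (u j))
  refine (hol.mono ?_).congr ?_
  · rintro w ⟨⟨-, -⟩, hw⟩
    exact hw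
  · rintro w ⟨⟨-, hws⟩, -, hwU⟩
    simp only [Function.comp_apply]
    rw [hu _ hws j, evalOrZero_appLE f hUle _ hwU]

/-- **`f(ℂ)` is `C^∞`** between the real manifolds `X(ℂ)`, `Y(ℂ)` of a morphism `f : X ⟶ Y` of
smooth `ℂ`-schemes locally of finite type (Serre, GAGA §2 n°5, p. 9: a regular map is holomorphic
on the analytifications). [cite: SerreGAGA1956, §2 n°5 (p. 9)] -/
theorem contMDiff_map (f : X ⟶ Y) :
    ContMDiff (𝓡 (2 * n)) (𝓡 (2 * m)) ∞ (AlgPoints.map f : ComplexPoints X → ComplexPoints Y) := by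
  haveI := isManifold_real X n
  haveI := isManifold_real Y m
  rw [contMDiff_iff]
  refine ⟨AlgPoints.continuous_map f, fun P Q => ?_⟩
  set LX := ContinuousLinearEquiv.ofFinrankEq (finrank_real_pi_complex_eq n) with hLX
  set LY := ContinuousLinearEquiv.ofFinrankEq (finrank_real_pi_complex_eq m) with hLY
  set aX := algebraicChart X n P with haX
  set aY := algebraicChart Y m Q with haY
  have hG := contDiffOn_chart_map (n := n) (m := m) f P Q
  have hfun : (extChartAt (𝓡 (2 * m)) Q ∘ AlgPoints.map f ∘ (extChartAt (𝓡 (2 * n)) P).symm :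
      EuclideanSpace ℝ (Fin (2 * n)) → EuclideanSpace ℝ (Fin (2 * m))) =
      LY ∘ (aY ∘ AlgPoints.map f ∘ aX.symm) ∘ LX.symm := by
    funext z
    rfl
  have hsrc : (extChartAt (𝓡 (2 * n)) P).target ∩
      (extChartAt (𝓡 (2 * n)) P).symm ⁻¹' (AlgPoints.map f ⁻¹' (extChartAt (𝓡 (2 * m)) Q).source) =
      LX.symm ⁻¹' (aX.target ∩ aX.symm ⁻¹' (AlgPoints.map f ⁻¹' aY.source)) := by
    ext z
    simp only [extChartAt, chartAt_eq, OpenPartialHomeomorph.extend_target,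
      OpenPartialHomeomorph.extend_source, OpenPartialHomeomorph.extend_coe_symm,
      modelWithCornersSelf_coe, modelWithCornersSelf_coe_symm, Set.range_id, Set.mem_univ, and_true,
      Set.preimage_id_eq, id_eq, Function.comp_apply, OpenPartialHomeomorph.transHomeomorph_target,
      OpenPartialHomeomorph.transHomeomorph_source, OpenPartialHomeomorph.transHomeomorph_symm_apply,
      coe_complexToEuclidean_symm, Set.mem_inter_iff, Set.mem_preimage]
    rfl
  rw [hfun, hsrc]
  refine LY.contDiff.comp_contDiffOn (ContDiffOn.comp ?_ LX.symm.contDiff.contDiffOn fun z hz => hz)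
  exact (hG.restrict_scalars ℝ).of_le le_top

/-- **A smooth morphism is a submersion on complex points** (SGA1 XII Prop. 3.1 (iv): `f` smooth
`⇒ f^an` smooth): for `f : X ⟶ Y` smooth between smooth `ℂ`-schemes locally of finite type, the
manifold derivative of `f(ℂ) : X(ℂ) → Y(ℂ)` is onto at every point — the complex Jacobian in
algebraic charts is onto (`surjective_fderiv_chart_map`, with local coordinates from
`exists_localCoordinates_le`), and the real derivative is its realification conjugated by
`ℂⁿ ≃ ℝ²ⁿ`. [cite: SGA1, Exp. XII Prop. 3.1 (iv)] -/
theorem surjective_mfderiv_map (f : X ⟶ Y) [Smooth f.left] (P : ComplexPoints X) :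
    Function.Surjective (mfderiv (𝓡 (2 * n)) (𝓡 (2 * m))
      (AlgPoints.map f : ComplexPoints X → ComplexPoints Y) P) := by
  classical
  set LX := ContinuousLinearEquiv.ofFinrankEq (finrank_real_pi_complex_eq n) with hLX
  set LY := ContinuousLinearEquiv.ofFinrankEq (finrank_real_pi_complex_eq m) with hLY
  set Q := AlgPoints.map f P with hQdef
  set aX := algebraicChart X n P with haX
  set aY := algebraicChart Y m Q with haY
  obtain ⟨⟨V₁, u, hsrcY, hu⟩, holY⟩ := algebraicChart_spec Y m Q
  obtain ⟨algX, holX⟩ := algebraicChart_spec X n P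
  have hP : P ∈ aX.source := mem_algebraicChart_source X n P
  have hQ : Q ∈ aY.source := mem_algebraicChart_source Y m Q
  have hQV₁ : Q.pt ∈ (↑V₁ : Y.left.Opens) := hsrcY hQ
  obtain ⟨U, hPU, hle, t, htspan⟩ :=
    exists_localCoordinates_le n P (f.left ⁻¹ᵁ ↑V₁) (show P.pt ∈ f.left ⁻¹ᵁ ↑V₁ from hQV₁)
  obtain ⟨hdiff, hsurj⟩ := surjective_fderiv_chart_map f aX hP holX algX aY hQ holY V₁ u hsrcY hu
    U hPU hle t htspan
  -- the complex chart expression `G` and the real one `LY ∘ G ∘ LX⁻¹`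
  set G : (Fin n → ℂ) → (Fin m → ℂ) := aY ∘ AlgPoints.map f ∘ aX.symm with hGdef
  set G' : (Fin n → ℂ) →L[ℂ] (Fin m → ℂ) := fderiv ℂ G (aX P) with hG'
  have hGd : HasFDerivAt G (G'.restrictScalars ℝ) (aX P) := (hdiff.hasFDerivAt).restrictScalars ℝ
  set D : EuclideanSpace ℝ (Fin (2 * n)) →L[ℝ] EuclideanSpace ℝ (Fin (2 * m)) :=
    (LY : (Fin m → ℂ) →L[ℝ] _).comp ((G'.restrictScalars ℝ).comp (LX.symm : _ →L[ℝ] (Fin n → ℂ)))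
    with hD
  have hwritten : writtenInExtChartAt (𝓡 (2 * n)) (𝓡 (2 * m)) P
      (AlgPoints.map f : ComplexPoints X → ComplexPoints Y) = LY ∘ G ∘ LX.symm := by
    funext z
    rfl
  have hpt : extChartAt (𝓡 (2 * n)) P P = LX (aX P) := rfl
  have hreal : HasFDerivAt (LY ∘ G ∘ LX.symm) D (LX (aX P)) := by
    have h1 : HasFDerivAt (LX.symm : _ → (Fin n → ℂ)) (LX.symm : _ →L[ℝ] (Fin n → ℂ)) (LX (aX P)) :=
      LX.symm.hasFDerivAt
    have h2 : HasFDerivAt G (G'.restrictScalars ℝ) (LX.symm (LX (aX P))) := by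
      rw [LX.symm_apply_apply]; exact hGd
    exact LY.hasFDerivAt.comp _ (h2.comp _ h1)
  have hmf : HasMFDerivAt (𝓡 (2 * n)) (𝓡 (2 * m))
      (AlgPoints.map f : ComplexPoints X → ComplexPoints Y) P D := by
    refine ⟨(AlgPoints.continuous_map f).continuousAt, ?_⟩
    rw [hwritten, hpt]
    exact hreal.hasFDerivWithinAt
  rw [hmf.mfderiv, hD]
  exact LY.surjective.comp (hsurj.comp LX.symm.surjective)

end Morphism

end ComplexPoints

end Literature.AlgebraicGeometry.Motives

end
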